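import Literature.MathematicalPhysics.QuantumFieldTheory.Balaban1983to89.Node00.OpsYCubeProjectionG
import Literature.MathematicalPhysics.QuantumFieldTheory.Balaban1983to89.Node00.OpsYDeltaALocalAgree
import Literature.MathematicalPhysics.QuantumFieldTheory.Balaban1983to89.Node00.OpsYCubeDirInverseBond
import Literature.MathematicalPhysics.QuantumFieldTheory.Balaban1983to89.B9Eq357CubeLetters
import Literature.MathematicalPhysics.QuantumFieldTheory.Balaban1983to89.B9WalkLettersOps310

/-!
# `Balaban1983to89.B9CubeDirInverseBondLocalityY` — [Balaban1985BackgroundPropagators] p. 410 l. 14–15 ∕ p. 413 FOR THE DIRICHLET BOND INVERSE `G_□(U)` OF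
# p. 409 l. 3–5 AT THE LETTERS OF RECORD: `G_□(U)` (`GDirBY … (DPDsDirCubeY x □ Ω₀(□)) (bondsOverY Ω₀(□))`) READS `U` ONLY NEAR `Ω₀(□)` — the `hOagrA` row of the
# N06 knit certificates («KE₁₄X-Aγ» ff.) from bond agreement and the averaging letter's locality law (L2)

T. Bałaban, *Propagators for lattice gauge theories in a background field*, Commun. Math. Phys. **99** (1985) 389–434 [Balaban1985BackgroundPropagators] = [B9]
(held `paper:balaban1985-cmp99-background-propagators`; journal page = PDF page + 388): p. 410 l. 14–15 («the operators G′_□(U), … depend on U restricted to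
Ω₀(□) ⊂ □̃⁵»), p. 413 («it depends on U restricted to X̃⁵»), p. 409 l. 1–5 (the operators `Q′_□, Δ′_{a,□}, G′_□, R_□, P_□, G_□` of the sequence `{Ω_n(□)}`),
(3.25)–(3.27) pp. 394–395, (3.3) p. 390, (3.8)–(3.10) p. 392, (3.12)–(3.14) p. 393 («Q … is a local operator»), (3.21) + (3.24) pp. 394–395.

WHY THIS FILE (seat dag-n06-d g33, the KNIT lane of N06).  The (γ) heads of record display the locality row
`hOagrA : agree310WalkYO x 𝔅 id (nearA x) □ U U′ → G_□(U) = G_□(U′)` at the bond letter of record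
`GDirBY x.toKIdx 𝔮 𝔮⋆ (DPDsDirCubeY x.toKIdx □ (dirDomY x.toKIdx □)) (bondsOverY x.toKIdx (dirDomY x.toKIdx □))`.  This file proves the operator-level and
pointwise locality of every letter in that word — the cube chain `Q′_□, X_□ = Q′_□G′_□²Q′*_□, X_□⁻¹, P_□, R_□, C_□` is OPERATOR-level local once `G′_□(U) = G′_□(U′)`
(def-Y's A-1 pattern `OpsYDeltaALocalAgree` §3, re-pressed for the cube sequence's blocks and the Dirichlet block cut), `D_U P_□(U) D*_U` and `Δ_loc[𝔮](U)` are
POINTWISE local on the vector fields supported over `Ω₀(□)` — and assembles `G_□(U) = G_□(U′)` from: bond agreement on an explicit finite READING SET of sites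
(`bondReadSetY`), and the averaging letter's locality law (L2) `IsLocalQ D 𝔮` with its dependency sets over `Ω₀(□)` read inside the agreement region.  At the
member this is the `hOagrA` row from `agree310WalkYO` plus two GEOMETRIC inclusions and (L2) — the shape the next edition displays instead of `hOagrA`.

WHAT IS PROVED (sorry-free; standard axioms; no estimate of the paper).
* §1 `QpLegAgreeY` (the `Q′_□`-leg agreement on a site set), `QpCubeY_comp_cubeProjY_congr`, `cubeProjY_comp_QpsCubeY_congr` (cube twins of def-Y's
  `QpY_comp_cubeProjY_congr` ∕ `cubeProjY_comp_QpsY_congr`), ★ `XCubeGY_congr`, `XinvCubeDY_congr`, ★ `PCubeDY_congr`, `RCubeDY_congr`, `CCubeDY_congr`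
  (OPERATOR-level: `G′(U) = G′(U′)` living on `S` + leg agreement on `S` ⟹ the chain agrees), ★ `DPDsCubeDY_apply_congr` (pointwise on fields read over `S`).
* §2 ★ `deltaLocQY_apply_congr` (pointwise locality of `Δ_loc[𝔮](U) = Δ(U) + DD* + 𝔮⋆a𝔮`), `q_congr_of_isLocalQ`, `adjTrY_apply_congr_of_isLocalQ` (the (L2) law
  delivers the `𝔮`- and `𝔮⋆ = adjTrY ∘ 𝔮`-agreements), ★★ `GDirBY_DPDsCubeDY_congr` ∕ `padDeltaLocBY_DPDsCubeDY_congr` (generic letters).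
  Also `IsLocalQs` (row locality of an adjoint letter), `isLocalQs_adjTrY`, `isLocalQs_qsKnitOfRecord`.
* The letters OF RECORD (`parKnitCubeY i □`, `GpDirY i □ (parKnitCubeY i □) S`, cut `insideBlkY S`), the agreement predicate `AgreeDirBY`, the reading set
  `bondReadSetY` and the member-level `hOagrA` theorem are the sibling `B9CubeDirInverseBondLocalityAtRecordY` (this file is its generic half; split for size).

HONEST SCOPE.  Bookkeeping (locality ∕ support chasing) over def-Y's letters; the only analytic input is NONE.  The (L2) law of the record's knit letter
`QknitY` with explicit double-block dependency sets is dag-n06-l's ✓`B9Eq3115KnitLetterYLaws.QknitY_apply_congr` (periodic reading) — its packaging as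
`IsLocalQ D (QknitY i)` is NOT done here (displayed by the consumer).  Count-neutral; N06 NOT discharged; nothing continuum ∕ OS ∕ mass gap ∕ Clay.  NEW file;
nothing landed is modified; no `instance`, no `notation`; 2 `def`s (`QpLegAgreeY` — an agreement predicate; `IsLocalQs` — a locality law, both `Prop`-valued with parameters).
-/

noncomputable section

namespace Literature.MathematicalPhysics.QuantumFieldTheory.Balaban1983to89.B9CubeDirInverseBondLocalityY

open B6KLevelCensusIndexV1 (KIdx)
open B6Cover236MultiLevelBlocks (cubes)
open B6Geom246MultiLevelBoxL0 (blkOf)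
open B9Eq39Adjoint (R)
open B9CubeLettersOpsL0 (cubeFamY)
open B9CubeLettersBondOpsL0 (BlkCubeY blkCornerCubeY qpKc qpsKc qpTc QpCubeY QpsCubeY cWtCubeY)
open B9Eq357CubeLetters (blkOf_of_qpKc_ne_zero blkOf_of_qpsKc_ne_zero)
open B9Eq360DeltaPrimeACubeY (cornerY_levCubeY_eq)
open B9CubeLettersOpsL0 (levCubeY)
open B6GlobalChartV1 (PV boxEquiv)
open B9Eq359CubeKernelsKnitAtOne (knitCubeY_congr_of_agree_block)
open B9Eq3105OfLocalInverseQ (deltaLocQY)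
open B9Thm37CubeCoverCommutators (cutMulY)
open B9CubeDirInverseKnitCubeLawsY (blkHullCubeY mem_blkHullCubeY GpDirY_parKnitCubeY_congr_of_agree padDeltaCubeY_parKnitCubeY_congr_of_agree)
open B9PinMembersKLevelV1 (MemberY)
open B9WalkLettersOps310 (agree310WalkYO)
open Node00
open Node00.OpsYNablaBridge (chartY shiftY_chartY shiftY_symm_chartY)
open Node00.OpsYLocalInverse (dirPadY dirInvY dirInvY_congr cubeProjY cubeProjY_apply)
open Node00.OpsYDeltaALocalAgree (trLiftY_apply_congr trLiftY_apply_congr' PlaqAgreeY hessY_apply_congr gradY_apply_congr divY_apply_congr)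
open Node00.OpsYCubeDirInverse (GpDirY cubeProjY_mul_GpDirY GpDirY_mul_cubeProjY)
open Node00.OpsYCubeKnitPar (parKnitCubeY parKnitCubeY_apply parOfTL knitTL parOfTL_corner_left)
open Node00.OpsYCubeProjectionG (blkProjY insideBlkY XCubeGY XinvCubeDY PCubeDY RCubeDY CCubeDY DPDsCubeDY XDirCubeY IsUnitXDirCubeY RDirCubeY PDirCubeY
  CDirCubeY DPDsDirCubeY RCubeDY_eq DPDsCubeDY_eq_gradY_PCubeDY_divY)
open Node00.OpsYCubeDirInverseBond (indProjY bondsOverY mem_bondsOverY padDeltaLocBY GDirBY GDirBY_congr_of_apply padDeltaLocBY_congr_of_apply)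
open Node00.OpsYQLetter (QLetterY QsLetterY IsLocalQ adjTrY adjTrY_apply unitFnY qKnitOfRecord qsKnitOfRecord)
open scoped Matrix Matrix.Norms.L2Operator

variable {d ℓ : ℕ} {hd : 1 ≤ d + 1} {hL : Odd (ℓ + 1) ∧ 1 < ℓ + 1} {b₀ b₁ : ℝ}
variable {𝔸 : Type} [NormedRing 𝔸] [NormedAlgebra ℂ 𝔸] [CompleteSpace 𝔸]

/-! ## §1 The cube chain `Q′_□, X_□, X_□⁻¹, P_□, R_□, C_□` is OPERATOR-level local once `G′_□(U) = G′_□(U′)`; `D P_□ D*` pointwise -/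

section Chain

variable (i : KIdx d ℓ hd hL b₀ b₁) (q : ↥(cubes (toKT i).D.toDomains))

/-- **`Q′_□`-leg agreement on a site set `D`**: the site transporters `parS U (c(s), z)` from the corner of the cube sequence's block `s ∋ z` agree at every
`z ∈ D` — exactly the transporters the rows of `Q′_□(U)P_D` and the columns of `P_D Q′*_□(U)` read ((3.21), (3.24)).
[cite: Balaban1985BackgroundPropagators, (3.21) p.394, (3.24) p.395, p.409 l.1–5, dictionary] -/
def QpLegAgreeY (parS : SiteParY 𝔸 i) (D : Finset (SiteY i)) (U U' : CfgY 𝔸 i) : Prop :=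
  ∀ z ∈ D, ∀ s : BlkCubeY i q, blkOf (cubeFamY i q).toDomains z = s → parS U (blkCornerCubeY i q s) z = parS U' (blkCornerCubeY i q s) z

variable {i q}

/-- ★ `Q′_□(U) ∘ P_D` reads the legs only at `z ∈ D` (cube twin of def-Y's ✓`QpY_comp_cubeProjY_congr`). [cite: Balaban1985BackgroundPropagators, (3.21) p.394, p.410 L14–15] -/
theorem QpCubeY_comp_cubeProjY_congr {parS : SiteParY 𝔸 i} {D : Finset (SiteY i)} {U U' : CfgY 𝔸 i} (h : QpLegAgreeY i q parS D U U') :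
    QpCubeY i q parS U ∘ₗ cubeProjY i D = QpCubeY i q parS U' ∘ₗ cubeProjY i D := by
  refine LinearMap.ext fun Λ => funext fun s => ?_
  simp only [LinearMap.coe_comp, Function.comp_apply]
  refine trLiftY_apply_congr fun z hz => ⟨rfl, fun hΛ => ?_⟩
  have hzD : z ∈ D := by
    by_contra hzD
    exact hΛ (by rw [cubeProjY_apply, if_neg hzD])
  unfold qpTc
  rw [h z hzD s (blkOf_of_qpKc_ne_zero i q hz)]

/-- ★ `P_D ∘ Q′*_□(U)` reads the legs only at `z ∈ D` (cube twin of def-Y's ✓`cubeProjY_comp_QpsY_congr`). [cite: Balaban1985BackgroundPropagators, (3.24) p.395, p.410 L14–15] -/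
theorem cubeProjY_comp_QpsCubeY_congr {parS : SiteParY 𝔸 i} {D : Finset (SiteY i)} {U U' : CfgY 𝔸 i} (h : QpLegAgreeY i q parS D U U') :
    cubeProjY i D ∘ₗ QpsCubeY i q parS U = cubeProjY i D ∘ₗ QpsCubeY i q parS U' := by
  refine LinearMap.ext fun Λ => funext fun z => ?_
  simp only [LinearMap.coe_comp, Function.comp_apply, cubeProjY_apply]
  by_cases hzD : z ∈ D
  · rw [if_pos hzD, if_pos hzD]
    exact trLiftY_apply_congr' fun s hs => ⟨rfl, by unfold qpTc; rw [h z hzD s (blkOf_of_qpsKc_ne_zero i q hs)]⟩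
  · rw [if_neg hzD, if_neg hzD]

variable {parS : SiteParY 𝔸 i} {Gp : SiteOpY 𝔸 i} {S : Finset (SiteY i)} {U U' : CfgY 𝔸 i}

/-- `Q′_□(U) ∘ G′ = Q′_□(U′) ∘ G′` for a site propagator living on `S` (`Ω₀G′ = G′`). [cite: Balaban1985BackgroundPropagators, (3.25) p.394, p.394 («Ω₀Δ′_aΩ₀»), p.410 L14–15] -/
theorem QpCubeY_comp_congr_of_proj (hPl : cubeProjY i S * Gp U' = Gp U') (hpar : QpLegAgreeY i q parS S U U') :
    QpCubeY i q parS U ∘ₗ Gp U' = QpCubeY i q parS U' ∘ₗ Gp U' := by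
  rw [← hPl, Module.End.mul_eq_comp, ← LinearMap.comp_assoc, QpCubeY_comp_cubeProjY_congr hpar, LinearMap.comp_assoc]

/-- `G′ ∘ Q′*_□(U) = G′ ∘ Q′*_□(U′)` for a site propagator living on `S` (`G′Ω₀ = G′`). [cite: Balaban1985BackgroundPropagators, (3.25) p.394, p.394 («Ω₀Δ′_aΩ₀»), p.410 L14–15] -/
theorem comp_QpsCubeY_congr_of_proj (hPr : Gp U' * cubeProjY i S = Gp U') (hpar : QpLegAgreeY i q parS S U U') :
    Gp U' ∘ₗ QpsCubeY i q parS U = Gp U' ∘ₗ QpsCubeY i q parS U' := by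
  rw [← hPr, Module.End.mul_eq_comp, LinearMap.comp_assoc, cubeProjY_comp_QpsCubeY_congr hpar, ← LinearMap.comp_assoc]

/-- ★ **`X_□(U) = Q′_□G′²Q′*_□(U)` IS OPERATOR-LEVEL LOCAL**: `G′(U) = G′(U′)` living on `S` and `Q′_□`-leg agreement on `S` give `X_□(U) = X_□(U′)`.
[cite: Balaban1985BackgroundPropagators, (3.25) p.394, p.409 l.1–5, p.410 L14–15] -/
theorem XCubeGY_congr (hGp : Gp U = Gp U') (hPl : cubeProjY i S * Gp U' = Gp U') (hPr : Gp U' * cubeProjY i S = Gp U') (hpar : QpLegAgreeY i q parS S U U') :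
    XCubeGY i q parS Gp U = XCubeGY i q parS Gp U' := by
  unfold XCubeGY
  rw [hGp, comp_QpsCubeY_congr_of_proj hPr hpar, ← LinearMap.comp_assoc, QpCubeY_comp_congr_of_proj hPl hpar, LinearMap.comp_assoc]

/-- ★ hence `X_□⁻¹(U) = X_□⁻¹(U′)` on every block cut `𝔖`. [cite: Balaban1985BackgroundPropagators, (3.25) p.394, p.409 l.1–5, p.410 L14–15] -/
theorem XinvCubeDY_congr (𝔖 : Finset (BlkCubeY i q)) (hGp : Gp U = Gp U') (hPl : cubeProjY i S * Gp U' = Gp U') (hPr : Gp U' * cubeProjY i S = Gp U')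
    (hpar : QpLegAgreeY i q parS S U U') : XinvCubeDY i q parS Gp 𝔖 U = XinvCubeDY i q parS Gp 𝔖 U' := by
  unfold XinvCubeDY
  rw [XCubeGY_congr hGp hPl hPr hpar]

/-- ★★ **`P_□(U) = G′Q′*_□X_□⁻¹Q′_□G′(U)` IS OPERATOR-LEVEL LOCAL.** [cite: Balaban1985BackgroundPropagators, (3.25) p.394, p.409 l.1–5, p.410 L14–15, (3.105) p.414] -/
theorem PCubeDY_congr (𝔖 : Finset (BlkCubeY i q)) (hGp : Gp U = Gp U') (hPl : cubeProjY i S * Gp U' = Gp U') (hPr : Gp U' * cubeProjY i S = Gp U')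
    (hpar : QpLegAgreeY i q parS S U U') : PCubeDY i q parS Gp 𝔖 U = PCubeDY i q parS Gp 𝔖 U' := by
  unfold PCubeDY
  rw [XinvCubeDY_congr 𝔖 hGp hPl hPr hpar, hGp, QpCubeY_comp_congr_of_proj hPl hpar, ← LinearMap.comp_assoc, comp_QpsCubeY_congr_of_proj hPr hpar,
    LinearMap.comp_assoc]

/-- ★ `R_□(U) = R_□(U′)`. [cite: Balaban1985BackgroundPropagators, (3.25) p.394, p.409 l.1–5, p.410 L14–15] -/
theorem RCubeDY_congr (𝔖 : Finset (BlkCubeY i q)) (hGp : Gp U = Gp U') (hPl : cubeProjY i S * Gp U' = Gp U') (hPr : Gp U' * cubeProjY i S = Gp U')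
    (hpar : QpLegAgreeY i q parS S U U') : RCubeDY i q parS Gp 𝔖 U = RCubeDY i q parS Gp 𝔖 U' := by
  rw [RCubeDY_eq, RCubeDY_eq, PCubeDY_congr 𝔖 hGp hPl hPr hpar]

/-- `C_□(U) = C_□(U′)`. [cite: Balaban1985BackgroundPropagators, (3.48) p.398, p.409 l.1–5, p.410 L14–15] -/
theorem CCubeDY_congr (𝔖 : Finset (BlkCubeY i q)) (hGp : Gp U = Gp U') (hPl : cubeProjY i S * Gp U' = Gp U') (hPr : Gp U' * cubeProjY i S = Gp U')
    (hpar : QpLegAgreeY i q parS S U U') : CCubeDY i q parS Gp 𝔖 U = CCubeDY i q parS Gp 𝔖 U' := by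
  unfold CCubeDY
  rw [XinvCubeDY_congr 𝔖 hGp hPl hPr hpar]

/-- `P_□(U′) ∘ Ω₀ = P_□(U′)`: the projection reads its argument on `S` only. [cite: Balaban1985BackgroundPropagators, (3.25) p.394, p.394 («Ω₀»), bookkeeping] -/
theorem PCubeDY_comp_cubeProjY (𝔖 : Finset (BlkCubeY i q)) (hPr : Gp U' * cubeProjY i S = Gp U') :
    PCubeDY i q parS Gp 𝔖 U' ∘ₗ cubeProjY i S = PCubeDY i q parS Gp 𝔖 U' := by
  unfold PCubeDY
  simp only [LinearMap.comp_assoc]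
  rw [← Module.End.mul_eq_comp (Gp U') (cubeProjY i S), hPr]

/-- ★★ **`(D_U P_□(U) D*_U A)(b) = (D_{U′} P_□(U′) D*_{U′} A)(b)`** — pointwise locality of the nonlocal part of `Δ_{a,□}`: for `P_□(U) = P_□(U′)` (operator level,
above), `U(b) = U′(b)` at the bond evaluated and at the bonds where `A ≠ 0`. [cite: Balaban1985BackgroundPropagators, (3.26) p.395, (3.105) p.414, p.410 L14–15, (3.3) + (3.8) pp.390–392] -/
theorem DPDsCubeDY_apply_congr (𝔖 : Finset (BlkCubeY i q)) (hP : PCubeDY i q parS Gp 𝔖 U = PCubeDY i q parS Gp 𝔖 U') (hPr : Gp U' * cubeProjY i S = Gp U')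
    {A : FBondY i → 𝔸} (hA : ∀ b', A b' ≠ 0 → U b'.dir b'.src = U' b'.dir b'.src) {b : FBondY i} (hb : U b.dir b.src = U' b.dir b.src) :
    DPDsCubeDY i q parS Gp 𝔖 U A b = DPDsCubeDY i q parS Gp 𝔖 U' A b := by
  rw [DPDsCubeDY_eq_gradY_PCubeDY_divY, DPDsCubeDY_eq_gradY_PCubeDY_divY]
  simp only [LinearMap.coe_comp, Function.comp_apply]
  have hdiv : cubeProjY (𝔸 := 𝔸) i S (divY i U A) = cubeProjY i S (divY i U' A) := by
    refine funext fun z => ?_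
    rw [cubeProjY_apply, cubeProjY_apply]
    split_ifs
    · exact divY_apply_congr fun b' _ => ⟨rfl, fun h => hA b' h⟩
    · rfl
  have hmid : PCubeDY i q parS Gp 𝔖 U (divY i U A) = PCubeDY i q parS Gp 𝔖 U' (divY i U' A) := by
    rw [hP, ← PCubeDY_comp_cubeProjY 𝔖 hPr, LinearMap.comp_apply, LinearMap.comp_apply, hdiv]
  rw [hmid]
  exact gradY_apply_congr hb fun _ _ => rfl

end Chain

/-! ## §2 `Δ_loc[𝔮](U)` pointwise; the (L2) law delivers the `𝔮`- and `𝔮⋆`-agreements; `G_□(U) = G_□(U′)` at generic letters -/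

section DeltaLoc

variable {i : KIdx d ℓ hd hL b₀ b₁}

/-- ★ **`(Δ_loc[𝔮](U)A)(b) = (Δ_loc[𝔮](U′)A)(b)`** — pointwise locality of `Δ(U) + D_UD*_U + 𝔮⋆(U)a𝔮(U)`: the plaquette variables around `b`, the bond `b`, the bonds
where `A ≠ 0` (the `D*`-rows), the value `𝔮(U)A = 𝔮(U′)A` and the `b`-row of `𝔮⋆`. [cite: Balaban1985BackgroundPropagators, (3.10) p.392, (3.3) + (3.8) pp.390–392, (3.12)–(3.14) p.393, (3.26) p.395, p.410 L14–15] -/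
theorem deltaLocQY_apply_congr {𝔮 : QLetterY 𝔸 i} {𝔮s : QsLetterY 𝔸 i} {U U' : CfgY 𝔸 i} {A : FBondY i → 𝔸} {b : FBondY i}
    (hp : ∀ p, (cocurlK i b p ≠ 0 ∨ ∃ m, edgeY i p m = b) → PlaqAgreeY i U U' p) (hb : U b.dir b.src = U' b.dir b.src)
    (hA : ∀ b', A b' ≠ 0 → U b'.dir b'.src = U' b'.dir b'.src) (hq : 𝔮 U A = 𝔮 U' A) (hqs : ∀ v, 𝔮s U v b = 𝔮s U' v b) :
    deltaLocQY i 𝔮 𝔮s U A b = deltaLocQY i 𝔮 𝔮s U' A b := by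
  simp only [deltaLocQY, LinearMap.add_apply, Pi.add_apply, LinearMap.coe_comp, Function.comp_apply]
  have hdiv : divY i U A = divY i U' A := funext fun z => divY_apply_congr fun b' _ => ⟨rfl, fun h => hA b' h⟩
  rw [hessY_apply_congr hp A, hdiv, gradY_apply_congr hb fun _ _ => rfl, hq, hqs]

/-- ★ **THE (L2) LAW DELIVERS `𝔮(U)A = 𝔮(U′)A` FOR FIELDS SUPPORTED IN `B`**: if `U ≡ U′` on every dependency set `D ι` meeting `B` (a dependency set missing `B` reads
`A ≡ 0` and gives `0` on both sides). [cite: Balaban1985BackgroundPropagators, (3.12)–(3.14) p.393 («Q … is a local operator»), p.413] -/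
theorem q_congr_of_isLocalQ {D : IBondY i → Set (FBondY i)} {𝔮 : QLetterY 𝔸 i} (hloc : IsLocalQ D 𝔮) {B : Finset (FBondY i)} {U U' : CfgY 𝔸 i}
    (hD : ∀ ι, (∃ b ∈ D ι, b ∈ B) → ∀ b ∈ D ι, U b.dir b.src = U' b.dir b.src) {A : FBondY i → 𝔸} (hA : ∀ b, b ∉ B → A b = 0) :
    𝔮 U A = 𝔮 U' A := by
  refine funext fun ι => ?_
  by_cases h : ∃ b ∈ D ι, b ∈ B
  · exact hloc U U' A A ι (hD ι h) fun _ _ => rfl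
  · have h0 : ∀ b ∈ D ι, A b = (0 : FBondY i → 𝔸) b := fun b hb => hA b fun hbB => h ⟨b, hb, hbB⟩
    rw [hloc U U A 0 ι (fun _ _ => rfl) h0, hloc U' U' A 0 ι (fun _ _ => rfl) h0, map_zero, map_zero]

variable (i) in
/-- ★ **ROW LOCALITY OF AN ADJOINT AVERAGING LETTER** relative to a dependency assignment `D`: the `b`-row `(𝔮⋆(U)v)(b)` reads `U` only on the dependency sets
`D ι ∋ b` (the law the generic adjoint `adjTrY ∘ 𝔮` inherits from (L2) `IsLocalQ D 𝔮`, below). [cite: Balaban1985BackgroundPropagators, (3.13) p.393 («Q*»), p.413, dictionary] -/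
def IsLocalQs (D : IBondY i → Set (FBondY i)) (𝔮s : QsLetterY 𝔸 i) : Prop :=
  ∀ (U U' : CfgY 𝔸 i) (b : FBondY i), (∀ ι, b ∈ D ι → ∀ b' ∈ D ι, U b'.dir b'.src = U' b'.dir b'.src) → ∀ v, 𝔮s U v b = 𝔮s U' v b

end DeltaLoc

section Adjoint

variable {N : ℕ} {i : KIdx d ℓ hd hL b₀ b₁}

/-- ★ **THE (L2) LAW DELIVERS THE `b`-ROW OF THE ADJOINT `𝔮⋆(U) = adjTrY (𝔮 U)`**: `(𝔮⋆(U)v)(b) = (𝔮⋆(U′)v)(b)` if `U ≡ U′` on every dependency set containing `b`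
(the adjoint's `b`-row reads `𝔮(·)(δ_b ⊗ E)`, which vanishes at the indices whose dependency set misses `b`). [cite: Balaban1985BackgroundPropagators, (3.13) p.393, p.413] -/
theorem adjTrY_apply_congr_of_isLocalQ {D : IBondY i → Set (FBondY i)} {𝔮 : QLetterY (Matrix (Fin N) (Fin N) ℂ) i} (hloc : IsLocalQ D 𝔮)
    {U U' : CfgY (Matrix (Fin N) (Fin N) ℂ) i} {b : FBondY i} (hD : ∀ ι, b ∈ D ι → ∀ b' ∈ D ι, U b'.dir b'.src = U' b'.dir b'.src)
    (v : IBondY i → Matrix (Fin N) (Fin N) ℂ) : adjTrY (𝔮 U) v b = adjTrY (𝔮 U') v b := by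
  refine Matrix.ext fun a c => ?_
  rw [adjTrY_apply, adjTrY_apply]
  have key : 𝔮 U (unitFnY b a c) = 𝔮 U' (unitFnY b a c) := by
    refine funext fun ι => ?_
    by_cases hι : b ∈ D ι
    · exact hloc U U' _ _ ι (hD ι hι) fun _ _ => rfl
    · have h0 : ∀ b' ∈ D ι, unitFnY b a c b' = (0 : FBondY i → Matrix (Fin N) (Fin N) ℂ) b' := fun b' hb' => by
        have hne : b' ≠ b := fun h => hι (h ▸ hb')
        unfold unitFnY
        rw [Pi.single_eq_of_ne hne, Pi.zero_apply]
      rw [hloc U U _ 0 ι (fun _ _ => rfl) h0, hloc U' U' _ 0 ι (fun _ _ => rfl) h0, map_zero, map_zero]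
  rw [key]

/-- ★ hence **(L2) for `𝔮` gives the row locality of its generic adjoint `U ↦ adjTrY (𝔮 U)`** (the record's `qsKnitOfRecord = adjTrY ∘ qKnitOfRecord`).
[cite: Balaban1985BackgroundPropagators, (3.13) p.393, p.413] -/
theorem isLocalQs_adjTrY {D : IBondY i → Set (FBondY i)} {𝔮 : QLetterY (Matrix (Fin N) (Fin N) ℂ) i} (hloc : IsLocalQ D 𝔮) :
    IsLocalQs i D (fun U => adjTrY (𝔮 U)) := fun _ _ _ hD v =>
  adjTrY_apply_congr_of_isLocalQ hloc hD v

/-- ★ at the record's knit pair: (L2) for `qKnitOfRecord N θ i` gives the row locality of `qsKnitOfRecord N θ i`. [cite: Balaban1985BackgroundPropagators, (3.13) p.393, p.413] -/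
theorem isLocalQs_qsKnitOfRecord [Nonempty (Fin N)] {θ : Stage3Params} (j : KIdx θ.d₆ θ.ℓ₆ θ.hd' θ.hL' θ.b₀ θ.b₁) {D : IBondY j → Set (FBondY j)}
    (hloc : IsLocalQ D (qKnitOfRecord N θ j)) : IsLocalQs j D (qsKnitOfRecord N θ j) :=
  isLocalQs_adjTrY hloc

end Adjoint

section Generic

variable {i : KIdx d ℓ hd hL b₀ b₁} {q : ↥(cubes (toKT i).D.toDomains)}
variable {parS : SiteParY 𝔸 i} {Gp : SiteOpY 𝔸 i} {S : Finset (SiteY i)} {𝔮 : QLetterY 𝔸 i} {𝔮s : QsLetterY 𝔸 i} {U U' : CfgY 𝔸 i}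

/-- the hypothesis of ✓`GDirBY_congr_of_apply` ∕ ✓`padDeltaLocBY_congr_of_apply` at `Pl = D P_□ D*`, `B = bondsOverY S`, from the letters' pointwise locality.
[cite: Balaban1985BackgroundPropagators, p.409 l.3–5, p.410 L14–15, (3.105) p.414] -/
theorem deltaLoc_sub_DPDsCubeDY_apply_congr (𝔖 : Finset (BlkCubeY i q)) (hP : PCubeDY i q parS Gp 𝔖 U = PCubeDY i q parS Gp 𝔖 U')
    (hPr : Gp U' * cubeProjY i S = Gp U') (hB : ∀ b : FBondY i, chartY i b.src ∈ S → U b.dir b.src = U' b.dir b.src)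
    (hp : ∀ b : FBondY i, chartY i b.src ∈ S → ∀ p, (cocurlK i b p ≠ 0 ∨ ∃ m, edgeY i p m = b) → PlaqAgreeY i U U' p)
    (hq : ∀ A : FBondY i → 𝔸, (∀ b, b ∉ bondsOverY i S → A b = 0) → 𝔮 U A = 𝔮 U' A)
    (hqs : ∀ b : FBondY i, chartY i b.src ∈ S → ∀ v, 𝔮s U v b = 𝔮s U' v b) :
    ∀ A : FBondY i → 𝔸, (∀ b, b ∉ bondsOverY i S → A b = 0) →
      ∀ b ∈ bondsOverY i S, (deltaLocQY i 𝔮 𝔮s U - DPDsCubeDY i q parS Gp 𝔖 U) A b = (deltaLocQY i 𝔮 𝔮s U' - DPDsCubeDY i q parS Gp 𝔖 U') A b := by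
  intro A hA b hb
  have hbS : chartY i b.src ∈ S := (mem_bondsOverY i).1 hb
  have hA' : ∀ b', A b' ≠ 0 → U b'.dir b'.src = U' b'.dir b'.src := fun b' h =>
    hB b' ((mem_bondsOverY i).1 (by by_contra h'; exact h (hA b' h')))
  rw [LinearMap.sub_apply, LinearMap.sub_apply, Pi.sub_apply, Pi.sub_apply,
    deltaLocQY_apply_congr (hp b hbS) (hB b hbS) hA' (hq A hA) (hqs b hbS), DPDsCubeDY_apply_congr 𝔖 hP hPr hA' (hB b hbS)]

/-- ★★ **`G_□(U) = G_□(U′)` AT GENERIC LETTERS** (`Pl_□ = D P_□ D*` over the cube sequence's blocks, `B = bondsOverY S`): from `P_□(U) = P_□(U′)`, `G′(U′)Ω₀ = G′(U′)`,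
bond agreement over `S`, plaquette agreement around the bonds over `S`, and the `𝔮`-∕`𝔮⋆`-agreements over `S`.
[cite: Balaban1985BackgroundPropagators, p.409 l.3–5 («G_□(U)»), p.410 L14–15, p.413, (3.105) p.414] -/
theorem GDirBY_DPDsCubeDY_congr (𝔖 : Finset (BlkCubeY i q)) (hP : PCubeDY i q parS Gp 𝔖 U = PCubeDY i q parS Gp 𝔖 U')
    (hPr : Gp U' * cubeProjY i S = Gp U') (hB : ∀ b : FBondY i, chartY i b.src ∈ S → U b.dir b.src = U' b.dir b.src)
    (hp : ∀ b : FBondY i, chartY i b.src ∈ S → ∀ p, (cocurlK i b p ≠ 0 ∨ ∃ m, edgeY i p m = b) → PlaqAgreeY i U U' p)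
    (hq : ∀ A : FBondY i → 𝔸, (∀ b, b ∉ bondsOverY i S → A b = 0) → 𝔮 U A = 𝔮 U' A)
    (hqs : ∀ b : FBondY i, chartY i b.src ∈ S → ∀ v, 𝔮s U v b = 𝔮s U' v b) :
    GDirBY i 𝔮 𝔮s (DPDsCubeDY i q parS Gp 𝔖) (bondsOverY i S) U = GDirBY i 𝔮 𝔮s (DPDsCubeDY i q parS Gp 𝔖) (bondsOverY i S) U' :=
  GDirBY_congr_of_apply i 𝔮 𝔮s _ _ (deltaLoc_sub_DPDsCubeDY_apply_congr 𝔖 hP hPr hB hp hq hqs)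

/-- ★ and the regime object `Ω₀(Δ_loc[𝔮] − D P_□ D*)Ω₀ ⊕ 1` agrees likewise. [cite: Balaban1985BackgroundPropagators, p.409 l.3–5, p.410 L14–15, bookkeeping] -/
theorem padDeltaLocBY_DPDsCubeDY_congr (𝔖 : Finset (BlkCubeY i q)) (hP : PCubeDY i q parS Gp 𝔖 U = PCubeDY i q parS Gp 𝔖 U')
    (hPr : Gp U' * cubeProjY i S = Gp U') (hB : ∀ b : FBondY i, chartY i b.src ∈ S → U b.dir b.src = U' b.dir b.src)
    (hp : ∀ b : FBondY i, chartY i b.src ∈ S → ∀ p, (cocurlK i b p ≠ 0 ∨ ∃ m, edgeY i p m = b) → PlaqAgreeY i U U' p)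
    (hq : ∀ A : FBondY i → 𝔸, (∀ b, b ∉ bondsOverY i S → A b = 0) → 𝔮 U A = 𝔮 U' A)
    (hqs : ∀ b : FBondY i, chartY i b.src ∈ S → ∀ v, 𝔮s U v b = 𝔮s U' v b) :
    padDeltaLocBY i 𝔮 𝔮s (DPDsCubeDY i q parS Gp 𝔖) (bondsOverY i S) U = padDeltaLocBY i 𝔮 𝔮s (DPDsCubeDY i q parS Gp 𝔖) (bondsOverY i S) U' :=
  padDeltaLocBY_congr_of_apply i 𝔮 𝔮s _ _ (deltaLoc_sub_DPDsCubeDY_apply_congr 𝔖 hP hPr hB hp hq hqs)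

end Generic

end Literature.MathematicalPhysics.QuantumFieldTheory.Balaban1983to89.B9CubeDirInverseBondLocalityY

end
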